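import Summits.BirchSwinnertonDyer.BirchSwinnertonDyer.Theorems.KolyvaginDepthDoorMSymbolCert944e1K
import Summits.BirchSwinnertonDyer.BirchSwinnertonDyer.Theorems.KolyvaginDepthDoorMSymbolCert794a1K
import HarnessLib

/-!
# Route `KolyvaginDepthDoor`, crux `KolyvaginDepthSupplyKN` (stmt-BirchSwinnertonDyer-22820) —
# DEPTH TABLE v30, DATA of `944e1`: piece 0/2 of the Kurihara sum at `(5, 5921)`

Helper file of the lead prover of line `levelone` (kdd-p1 g35; `--supports stmt-BirchSwinnertonDyer-22820 --as helper`);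
MACHINE-WRITTEN DATA + `decide` (generator `work/py/genq_lean.py`, kit 1″ `…MSymbolCertCosetsQ/CosetsCQ`). Kernel evaluation of `∑_{0 ≤ k < 3838} gE944 k` (87915 continued-fraction steps, three `decide` sub-chunks). It closes nothing and BSD is NOT proved by it.

References: [CremonaAlgorithms1997] §2.2–2.5, §2.8, Table 1 (944e1); [PopaZagier2017] §4 (13); [Kim2022StructureSelmer] §1.4.3;
[MazurTateTeitelbaum1986Invent] §I.8.
-/

set_option linter.dupNamespace false
-- the packed numerals are long literals
set_option linter.style.longLine false

noncomputable section

open scoped MatrixGroups ModularForm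
open CongruenceSubgroup
open Literature.NumberTheory.EllipticCurves Literature.NumberTheory.EllipticCurves.ModularForms
open Literature.NumberTheory.Automorphic.PopaZagier (coeff12 coeff12M coeff coeffN)
open Summit.BirchSwinnertonDyer.BirchSwinnertonDyer.Rank2Observatory
open Summit.BirchSwinnertonDyer.BirchSwinnertonDyer.Rank1Residual (IntModel.frobeniusTrace_eq IntModel.minimalDiscriminantInt_eq)
open Summit.BirchSwinnertonDyer.BirchSwinnertonDyer.Theorems.KolyvaginDepthDoor.MSymbolCert.Cert389a1
  (H3 H3fin support_subset_H3fin H3fin_det H3mat_nodup H3_det H3_coeff eval_map eval_append)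
open Summit.BirchSwinnertonDyer.BirchSwinnertonDyer.Theorems.KolyvaginDepthDoor.MSymbolCert.Level5921
open Summit.BirchSwinnertonDyer.BirchSwinnertonDyer.Theorems.KolyvaginDepthDoor.MSymbolCert.Cert794a1 (list_range'_map_sum_split)

namespace Summit.BirchSwinnertonDyer.BirchSwinnertonDyer.Theorems.KolyvaginDepthDoor.MSymbolCert.Cert944e1

set_option maxHeartbeats 4000000 in
/-- **Piece 0 of the Kurihara sum of `944e1` at `(5, 5921)`**: `∑_{0 ≤ k < 3838} gE944 k = 1` in `ZMod 5` (decide). [cite: Kim2022StructureSelmer, §1.4.3] -/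
theorem kSumPiece0 : ((List.range' 0 3838).map gE944).sum = ((1 : ℕ) : ZMod 5) := by
  have h0 : ((List.range' 0 1481).map gE944).sum = ((4 : ℕ) : ZMod 5) := by decide +kernel
  have h1 : ((List.range' (0 + 1481) 1272).map gE944).sum = ((0 : ℕ) : ZMod 5) := by decide +kernel
  have h2 : ((List.range' (0 + (1481 + 1272)) 1085).map gE944).sum = ((2 : ℕ) : ZMod 5) := by decide +kernel
  have e := list_range'_map_sum_split gE944 0 (1481 + 1272) 1085 _ _ (list_range'_map_sum_split gE944 0 1481 1272 _ _ h0 h1) h2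
  refine (show ((List.range' 0 3838).map gE944).sum = ((List.range' 0 (1481 + 1272 + 1085)).map gE944).sum from rfl).trans
    (e.trans ?_)
  decide

end Summit.BirchSwinnertonDyer.BirchSwinnertonDyer.Theorems.KolyvaginDepthDoor.MSymbolCert.Cert944e1

end
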